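import Summits.CriticalPhenomena.PercolationContinuityZ3.Theorems.PercNearOneGluingNoHeavyLowerTailQ7PsiSetObserverGluedQ9
import Summits.CriticalPhenomena.PercolationContinuityZ3.Theorems.PercNearOneGluingNoHeavyLowerTailHullPortTANSetMarkerDominance
import Summits.CriticalPhenomena.PercolationContinuityZ3.Theorems.PercNearOneGluingNoHeavyLowerTailKnQuestion9TwoRelays
import HarnessLib

/-!
# `NoHeavyLowerTail` (stmt-CriticalPhenomena-4575) — KOZMA–NITZAN'S QUESTION 9 HOLDS FOR THREE RELAYS
# (every finite weighted graph, every weight vector, every neighbourhood of the observer), and (GΨ₃) for a SET of observers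

Support file (`--supports stmt-CriticalPhenomena-4575`, closed), coupling seat `prim-cplus-coupling` (gen 14): the B7 assembly
of memo A5-COUPLING-gen13.md §5.  No definitions, no named facts, no sorries.

Kozma–Nitzan (arXiv:2401.12397, §5.5 p. 36), QUESTION 9: "Let `H` be the graph given from `G` by removing all edges going out
of `0`.  Let `a` be the point minimising `P_H(a ↔ b)` among the points of `A`.  Is it true that in this case (41)
`P(0 ↔ b, 0 ↔ A) ≥ P(0 ↔ A, a ↔ b)` holds?"  The tree answered it for `|A| ≤ 2` (`KnQ9.knQuestion9_of_card_le_two`,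
prim-lf-2) and reduced the general case, star by star at the observer (`KnQ9.block41_of_stars`), to the GLUED-SET inequality
`μ_H(({z↔b} ∪ ({N↔z} ∩ {N↔b})) ∩ {N↔A}) ≤ μ_H({N↔b} ∩ {N↔A})` for vertex sets `N`; for `|A| = 3` the coupling seat reduced
the glued-set inequality to the SET-OBSERVER MARKER DOMINANCE LEMMA (12 files `…Q7PsiSetObserver*.lean`, final socket
`Q7Psi.gluedPreFKG_three_of_setMDL_allWeights`), and prim-hp-7 proved that lemma (`HullPort.setMarkerDominance_hcov`,
`…HullPortTANSetMarkerDominance.lean`, by the `T_A` induction).  This file plugs the pieces together: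

* `Q7Psi.setMDL_schema` — the marker dominance schema (hypothesis `hMDL` of the `…AllWeights` files) HOLDS on every finite
  vertex type (it is `HullPort.setMarkerDominance_hcov`, which needs neither non-degeneracy nor `x ≠ z`, `y ≠ z`);
* `Q7Psi.gpsi_three_set_robust` / `gpsi_three_set` / `gpsi_three_glued_robust` / `gpsi_three_glued` — **(GΨ₃) for a SET
  of observers**, set and glued (restricted to `{z ↮ N}`) forms, every weight vector, every monotone cluster property:
  `E F(C_z) ≤ E F(C_x), E F(C_y)` ⟹ `∫_J F(C_z) ≤ ∫_J F(C_N)`, `J = {x↔N} ∪ {y↔N}` (resp. `J ∩ {z↮N}`), `C_N = ⋃_{n∈N} C_n`;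
* `Q7Psi.gluedPreFKG_three` — **the glued pre-FKG inequality (41) at three relays with NO side condition**: for all
  `w, N, b, x, y, z` with `μ(z↔b) ≤ μ(x↔b), μ(y↔b)`:
  `μ(({z↔b} ∪ ({N↔z} ∩ {N↔b})) ∩ {N↔{x,y,z}}) ≤ μ({N↔b} ∩ {N↔{x,y,z}})` = (41) in `G/N` with designation in `G`
  (= prim-lf-3's "anchored `q7_three`"); the degenerate cases `b ∈ N`, coincident relays, `b ∈ {x,y,z}` are reduced to
  prim-lf-2's two-relay comparison `KnQ9.glued_pair_le`; `Q7Psi.setPreFKG_three` — the weaker set form;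
* `KnQ9.knQuestion9_three` — **QUESTION 9 FOR THREE RELAYS**: `x, y, z ≠ 0`, `μ_H(z↔b) ≤ μ_H(x↔b), μ_H(y↔b)` with
  `H = restrW {0}ᶜ w` ⟹ `μ({z↔b} ∩ {0↔{x,y,z}}) ≤ μ({0↔b} ∩ {0↔{x,y,z}})`;
  `KnQ9.knQuestion9_of_card_le_three` — the same for every relay set with `|A| ≤ 3`, in the shape of the hypothesis of
  `SoloBlindKN.knQuestion7_of_question9` / `KnQ9Sure.question9_of_sureObserver`.
Printed status (prim-gen-literature S106): Question 9 is open in print for every `|A| ≥ 2` beyond Theorems 4–5 (pp. 12–13: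
`0` joined only to `A`, or to `A` and one good vertex); nothing of (41)-type for set / glued observers is in print.
[cite: KozmaNitzan2024, Question 9 (§5.5 p. 36); Lemma 5, Theorems 4–5 (pp. 12–14); §5.1 (pp. 31–32)]
[cite: VandenbergHaggstromKahn2005, Thms. 1.3–1.5 (pp. 6–8)]
-/

namespace Summit.CriticalPhenomena.PercolationContinuityZ3.Theorems

open MeasureTheory Set Literature.Probability.LatticeModels Literature.Probability.Percolation
open scoped Classical
open KNPreFKG

noncomputable section

namespace Q7Psi

universe u

variable {V : Type u} [Fintype V]

/-- **The set-observer marker dominance schema holds** on every finite vertex type: this is prim-hp-7's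
`HullPort.setMarkerDominance_hcov` (which needs neither the non-degeneracy of the weights nor `x ≠ z`, `y ≠ z`), in the
literal shape of the hypothesis `hMDL` of `Q7Psi.setPreFKG_three_of_setMDL_allWeights` /
`Q7Psi.gluedPreFKG_three_of_setMDL_allWeights`.
[cite: KozmaNitzan2024, §5.1 (pp. 31–32), Question 9 (p. 36)] [cite: VandenbergHaggstromKahn2005, Thms 1.3–1.5 (pp. 6–7)] -/
theorem setMDL_schema (W : Type u) [Fintype W] (p : Sym2 W → unitInterval) (_hp : ∀ e, 0 < p e ∧ p e < 1)
    (x y z : W) (N : Set W) (hxy : x ≠ y) (_hxz : x ≠ z) (_hyz : y ≠ z) (G : Set W → ℝ)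
    (hG : ∀ S T : Set W, S ⊆ T → G S ≤ G T) :
    (prodBernoulli p).real ({ω : BondConfig W | ∃ n ∈ N, (openGraph ω).Reachable y n} ∩
          ({ω | ∀ n ∈ N, ¬ (openGraph ω).Reachable x n} ∩ {ω | ∀ n ∈ N, ¬ (openGraph ω).Reachable z n})) *
      ((prodBernoulli p).real {ω : BondConfig W | ¬ (openGraph ω).Reachable x z} *
          (∫ ω in openConn x y ∩ {ω | ¬ (openGraph ω).Reachable x z}, G (openCluster ω x) ∂(prodBernoulli p)) -
        (prodBernoulli p).real (openConn x y ∩ {ω | ¬ (openGraph ω).Reachable x z}) *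
          ∫ ω in {ω : BondConfig W | ¬ (openGraph ω).Reachable x z}, G (openCluster ω x) ∂(prodBernoulli p)) ≤
    (prodBernoulli p).real ({ω : BondConfig W | ¬ (openGraph ω).Reachable y x} ∩
        {ω | ¬ (openGraph ω).Reachable y z}) *
      ((prodBernoulli p).real {ω : BondConfig W | ¬ (openGraph ω).Reachable x z} *
          (∫ ω in {ω : BondConfig W | ∃ n ∈ N, (openGraph ω).Reachable x n} ∩
            {ω | ∀ n ∈ N, ¬ (openGraph ω).Reachable z n}, G (openCluster ω x) ∂(prodBernoulli p)) -
        (prodBernoulli p).real ({ω : BondConfig W | ∃ n ∈ N, (openGraph ω).Reachable x n} ∩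
            {ω | ∀ n ∈ N, ¬ (openGraph ω).Reachable z n}) *
          ∫ ω in {ω : BondConfig W | ¬ (openGraph ω).Reachable x z}, G (openCluster ω x) ∂(prodBernoulli p)) :=
  HullPort.setMarkerDominance_hcov p x y z N hxy G hG

/-- **(GΨ₃) for a set of observers, robust form, every weight vector.**  Distinct `x, y, z`, an observer set `N`, `F`
monotone: `min(Dx,0) + min(Dy,0) ≤ ∫_J F(C_N) − ∫_J F(C_z)`, `J = {x↔N} ∪ {y↔N}`, `Dv = E F(C_v) − E F(C_z)`.
[cite: KozmaNitzan2024, §5.1 (pp. 31–32), Question 9 (p. 36)] -/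
theorem gpsi_three_set_robust (w : Sym2 V → unitInterval) (x y z : V) (N : Set V) (hxy : x ≠ y) (hxz : x ≠ z)
    (hyz : y ≠ z) (F : Set V → ℝ) (hF : ∀ S T : Set V, S ⊆ T → F S ≤ F T) :
    min ((∫ ω, F (openCluster ω x) ∂(prodBernoulli w)) - ∫ ω, F (openCluster ω z) ∂(prodBernoulli w)) 0 +
        min ((∫ ω, F (openCluster ω y) ∂(prodBernoulli w)) - ∫ ω, F (openCluster ω z) ∂(prodBernoulli w)) 0 ≤
      (∫ ω in {ω : BondConfig V | ∃ n ∈ N, (openGraph ω).Reachable x n} ∪ {ω | ∃ n ∈ N, (openGraph ω).Reachable y n},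
          F (⋃ n ∈ N, openCluster ω n) ∂(prodBernoulli w)) -
        ∫ ω in {ω : BondConfig V | ∃ n ∈ N, (openGraph ω).Reachable x n} ∪ {ω | ∃ n ∈ N, (openGraph ω).Reachable y n},
          F (openCluster ω z) ∂(prodBernoulli w) :=
  gpsi_three_set_robust_allWeights (fun p hp x y z N hxy hxz hyz G hG => setMDL_schema V p hp x y z N hxy hxz hyz G hG)
    w x y z N hxy hxz hyz F hF

/-- **(GΨ₃) for a set of observers, every weight vector, every monotone cluster property** (Kozma–Nitzan's Conjecture-4 shape
with the observer replaced by a vertex set `N` and `C_N = ⋃_{n∈N} C_n`): for distinct `x, y, z` with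
`E F(C_z) ≤ E F(C_x), E F(C_y)`:  `∫_{x↔N ∪ y↔N} F(C_z) ≤ ∫_{x↔N ∪ y↔N} F(C_N)`.
[cite: KozmaNitzan2024, Conjecture 4 and §5.1 (pp. 31–32), Question 9 (p. 36)] -/
theorem gpsi_three_set (w : Sym2 V → unitInterval) (x y z : V) (N : Set V) (hxy : x ≠ y) (hxz : x ≠ z) (hyz : y ≠ z)
    (F : Set V → ℝ) (hF : ∀ S T : Set V, S ⊆ T → F S ≤ F T)
    (hDx : ∫ ω, F (openCluster ω z) ∂(prodBernoulli w) ≤ ∫ ω, F (openCluster ω x) ∂(prodBernoulli w))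
    (hDy : ∫ ω, F (openCluster ω z) ∂(prodBernoulli w) ≤ ∫ ω, F (openCluster ω y) ∂(prodBernoulli w)) :
    ∫ ω in {ω : BondConfig V | ∃ n ∈ N, (openGraph ω).Reachable x n} ∪ {ω | ∃ n ∈ N, (openGraph ω).Reachable y n},
        F (openCluster ω z) ∂(prodBernoulli w) ≤
      ∫ ω in {ω : BondConfig V | ∃ n ∈ N, (openGraph ω).Reachable x n} ∪ {ω | ∃ n ∈ N, (openGraph ω).Reachable y n},
        F (⋃ n ∈ N, openCluster ω n) ∂(prodBernoulli w) :=
  gpsi_three_set_of_setMDL_allWeights (fun p hp x y z N hxy hxz hyz G hG => setMDL_schema V p hp x y z N hxy hxz hyz G hG)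
    w x y z N hxy hxz hyz F hF hDx hDy

/-- **The GLUED form of (GΨ₃) for a set of observers, robust, every weight vector**: as `gpsi_three_set_robust` with the
integrals restricted to `{z ↮ N}` (on `{z ↔ N}` the clusters of `z` and `[N]` coincide in `G/N`).
[cite: KozmaNitzan2024, §5.1 (pp. 31–32), Question 9 (p. 36)] -/
theorem gpsi_three_glued_robust (w : Sym2 V → unitInterval) (x y z : V) (N : Set V) (hxy : x ≠ y) (hxz : x ≠ z)
    (hyz : y ≠ z) (F : Set V → ℝ) (hF : ∀ S T : Set V, S ⊆ T → F S ≤ F T) :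
    min ((∫ ω, F (openCluster ω x) ∂(prodBernoulli w)) - ∫ ω, F (openCluster ω z) ∂(prodBernoulli w)) 0 +
        min ((∫ ω, F (openCluster ω y) ∂(prodBernoulli w)) - ∫ ω, F (openCluster ω z) ∂(prodBernoulli w)) 0 ≤
      (∫ ω in ({ω : BondConfig V | ∃ n ∈ N, (openGraph ω).Reachable x n} ∪ {ω | ∃ n ∈ N, (openGraph ω).Reachable y n}) ∩
            {ω | ∀ n ∈ N, ¬ (openGraph ω).Reachable z n},
          F (⋃ n ∈ N, openCluster ω n) ∂(prodBernoulli w)) -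
        ∫ ω in ({ω : BondConfig V | ∃ n ∈ N, (openGraph ω).Reachable x n} ∪ {ω | ∃ n ∈ N, (openGraph ω).Reachable y n}) ∩
            {ω | ∀ n ∈ N, ¬ (openGraph ω).Reachable z n},
          F (openCluster ω z) ∂(prodBernoulli w) :=
  gpsi_three_glued_robust_allWeights (fun p hp x y z N hxy hxz hyz G hG => setMDL_schema V p hp x y z N hxy hxz hyz G hG)
    w x y z N hxy hxz hyz F hF

/-- **The GLUED form of (GΨ₃) for a set of observers, every weight vector**: for distinct `x, y, z` with
`E F(C_z) ≤ E F(C_x), E F(C_y)`:  `∫_{J ∩ {z↮N}} F(C_z) ≤ ∫_{J ∩ {z↮N}} F(C_N)`, `J = {x↔N} ∪ {y↔N}`.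
[cite: KozmaNitzan2024, §5.1 (pp. 31–32), Question 9 (p. 36)] -/
theorem gpsi_three_glued (w : Sym2 V → unitInterval) (x y z : V) (N : Set V) (hxy : x ≠ y) (hxz : x ≠ z) (hyz : y ≠ z)
    (F : Set V → ℝ) (hF : ∀ S T : Set V, S ⊆ T → F S ≤ F T)
    (hDx : ∫ ω, F (openCluster ω z) ∂(prodBernoulli w) ≤ ∫ ω, F (openCluster ω x) ∂(prodBernoulli w))
    (hDy : ∫ ω, F (openCluster ω z) ∂(prodBernoulli w) ≤ ∫ ω, F (openCluster ω y) ∂(prodBernoulli w)) :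
    ∫ ω in ({ω : BondConfig V | ∃ n ∈ N, (openGraph ω).Reachable x n} ∪ {ω | ∃ n ∈ N, (openGraph ω).Reachable y n}) ∩
            {ω | ∀ n ∈ N, ¬ (openGraph ω).Reachable z n},
        F (openCluster ω z) ∂(prodBernoulli w) ≤
      ∫ ω in ({ω : BondConfig V | ∃ n ∈ N, (openGraph ω).Reachable x n} ∪ {ω | ∃ n ∈ N, (openGraph ω).Reachable y n}) ∩
            {ω | ∀ n ∈ N, ¬ (openGraph ω).Reachable z n},
        F (⋃ n ∈ N, openCluster ω n) ∂(prodBernoulli w) :=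
  gpsi_three_glued_of_setMDL_allWeights (fun p hp x y z N hxy hxz hyz G hG => setMDL_schema V p hp x y z N hxy hxz hyz G hG)
    w x y z N hxy hxz hyz F hF hDx hDy

/-- **The glued pre-FKG inequality (41) at three relays — Kozma–Nitzan Question 9 at `|A| = 3`, glued / anchored form — with no
side condition.**  On every finite weighted graph, for every vertex set `N`, target `b` and relays `x, y, z` with
`μ(z↔b) ≤ μ(x↔b)` and `μ(z↔b) ≤ μ(y↔b)`:
`μ(({z↔b} ∪ ({N↔z} ∩ {N↔b})) ∩ {N↔{x,y,z}}) ≤ μ({N↔b} ∩ {N↔{x,y,z}})`,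
i.e. (41) at the vertex `[N]` of `G/N` for the relay designated in `G` (prim-lf-3's "anchored `q7_three`").  The generic case
(`b ∉ N ∪ {x,y,z}`, distinct relays) is `gluedPreFKG_three_of_setMDL_allWeights` + `setMDL_schema`; `b ∈ N` is trivial; coincident
relays and `b ∈ {x,y,z}` reduce to prim-lf-2's two-relay comparison `KnQ9.glued_pair_le` (for `b = z` through the null sets
`{N↔x} ∖ {N↔z}`, `{N↔y} ∖ {N↔z}`).
[cite: KozmaNitzan2024, Question 9 (§5.5 p. 36), Lemma 3(i) (pp. 6–7), §5.1 (pp. 31–32)] -/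
theorem gluedPreFKG_three (w : Sym2 V → unitInterval) (N : Set V) (b x y z : V)
    (hzx : (prodBernoulli w).real (openConn z b) ≤ (prodBernoulli w).real (openConn x b))
    (hzy : (prodBernoulli w).real (openConn z b) ≤ (prodBernoulli w).real (openConn y b)) :
    (prodBernoulli w).real ((openConn z b ∪ ({ω : BondConfig V | ∃ n ∈ N, (openGraph ω).Reachable n z} ∩
        {ω : BondConfig V | ∃ n ∈ N, (openGraph ω).Reachable n b})) ∩
        ⋃ a ∈ ({x, y, z} : Finset V), {ω : BondConfig V | ∃ n ∈ N, (openGraph ω).Reachable n a}) ≤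
      (prodBernoulli w).real ({ω : BondConfig V | ∃ n ∈ N, (openGraph ω).Reachable n b} ∩
        ⋃ a ∈ ({x, y, z} : Finset V), {ω : BondConfig V | ∃ n ∈ N, (openGraph ω).Reachable n a}) := by
  set μ := prodBernoulli w with hμ
  have hmeas : ∀ X : Set (BondConfig V), MeasurableSet X := fun _ => MeasurableSet.of_discrete
  -- notation: `Nv v = {N ↔ v}`, `U = {N ↔ {x,y,z}}`, `L` the left event
  set Nv : V → Set (BondConfig V) := fun v => {ω : BondConfig V | ∃ n ∈ N, (openGraph ω).Reachable n v} with hNv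
  set U : Set (BondConfig V) := ⋃ a ∈ ({x, y, z} : Finset V), Nv a with hU
  set L : Set (BondConfig V) := openConn z b ∪ (Nv z ∩ Nv b) with hL
  have hUmem : ∀ ω, ω ∈ U ↔ ω ∈ Nv x ∨ ω ∈ Nv y ∨ ω ∈ Nv z := by
    intro ω
    simp only [hU, mem_iUnion, Finset.mem_insert, Finset.mem_singleton, exists_prop]
    constructor
    · rintro ⟨a, rfl | rfl | rfl, h⟩
      · exact Or.inl h
      · exact Or.inr (Or.inl h)
      · exact Or.inr (Or.inr h)
    · rintro (h | h | h)
      · exact ⟨x, Or.inl rfl, h⟩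
      · exact ⟨y, Or.inr (Or.inl rfl), h⟩
      · exact ⟨z, Or.inr (Or.inr rfl), h⟩
  have hzU : Nv z ⊆ U := fun ω h => (hUmem ω).2 (Or.inr (Or.inr h))
  change μ.real (L ∩ U) ≤ μ.real (Nv b ∩ U)
  -- `b ∈ N`: the right event is all of `U`
  by_cases hbN : b ∈ N
  · exact measureReal_mono fun ω hω => ⟨⟨b, hbN, SimpleGraph.Reachable.refl _⟩, hω.2⟩
  -- the two-relay comparison (prim-lf-2), for a strong relay `v`
  have hpair : ∀ v : V, μ.real (openConn z b) ≤ μ.real (openConn v b) →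
      μ.real (L ∩ (Nv v ∪ Nv z)) ≤ μ.real (Nv b ∩ (Nv v ∪ Nv z)) := by
    intro v hv
    have key := KnQ9.glued_pair_le w v z b N hv
    have hcomm : {ω : BondConfig V | ∃ u ∈ N, (openGraph ω).Reachable z u} = Nv z := by
      ext ω
      simp only [hNv, mem_setOf_eq]
      exact exists_congr fun u => and_congr_right fun _ => SimpleGraph.reachable_comm
    rw [hcomm] at key
    exact key
  -- coincident relays
  by_cases hxy : x = y
  · subst hxy
    have hU2 : U = Nv x ∪ Nv z := by
      ext ω; rw [hUmem]; simp only [mem_union, or_self_left]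
    rw [hU2]
    exact hpair x hzx
  by_cases hxz : x = z
  · subst hxz
    have hU2 : U = Nv y ∪ Nv x := by
      ext ω; rw [hUmem]; simp only [mem_union]; tauto
    rw [hU2]
    exact hpair y hzy
  by_cases hyz : y = z
  · subst hyz
    have hU2 : U = Nv x ∪ Nv y := by
      ext ω; rw [hUmem]; simp only [mem_union]; tauto
    rw [hU2]
    exact hpair x hzx
  -- `b = z`: `{N↔x} ∖ {N↔z}` and `{N↔y} ∖ {N↔z}` are null
  by_cases hzb : z = b
  · subst hzb
    have hnull : ∀ v : V, μ.real (openConn z z) ≤ μ.real (openConn v z) → μ.real (Nv v ∪ Nv z) ≤ μ.real (Nv z) := by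
      intro v hv
      have h1 := hpair v hv
      have hLU : L ∩ (Nv v ∪ Nv z) = Nv v ∪ Nv z := by
        refine inter_eq_right.2 fun ω _ => Or.inl ?_
        exact SimpleGraph.Reachable.refl _
      rw [hLU] at h1
      exact h1.trans (measureReal_mono inter_subset_left)
    have hx1 := hnull x hzx
    have hy1 := hnull y hzy
    have hUeq : U = (Nv x ∪ Nv z) ∪ (Nv y ∪ Nv z) := by
      ext ω; rw [hUmem]; simp only [mem_union]; tauto
    have hIE := measureReal_union_add_inter (μ := μ) (s := Nv x ∪ Nv z) (hmeas (Nv y ∪ Nv z))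
    have hint : μ.real (Nv z) ≤ μ.real ((Nv x ∪ Nv z) ∩ (Nv y ∪ Nv z)) :=
      measureReal_mono fun ω h => ⟨Or.inr h, Or.inr h⟩
    calc μ.real (L ∩ U) ≤ μ.real U := measureReal_mono inter_subset_right (measure_ne_top _ _)
      _ = μ.real ((Nv x ∪ Nv z) ∪ (Nv y ∪ Nv z)) := by rw [hUeq]
      _ ≤ μ.real (Nv z) := by linarith
      _ ≤ μ.real (Nv z ∩ U) := measureReal_mono fun ω h => ⟨h, hzU h⟩
  -- `b = x` / `b = y`: the left event lies inside the two-relay one for the OTHER strong relay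
  by_cases hxb : x = b
  · subst hxb
    calc μ.real (L ∩ U) ≤ μ.real (L ∩ (Nv y ∪ Nv z)) := by
          refine measureReal_mono fun ω hω => ⟨hω.1, ?_⟩
          rcases (hUmem ω).1 hω.2 with hx | hy | hz
          · rcases hω.1 with hzb' | ⟨hz', _⟩
            · obtain ⟨n, hn, hnx⟩ := hx
              exact Or.inr ⟨n, hn, hnx.trans (hzb' : (openGraph ω).Reachable z x).symm⟩
            · exact Or.inr hz'
          · exact Or.inl hy
          · exact Or.inr hz
      _ ≤ μ.real (Nv x ∩ (Nv y ∪ Nv z)) := hpair y hzy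
      _ ≤ μ.real (Nv x ∩ U) :=
          measureReal_mono fun ω hω => ⟨hω.1, (hUmem ω).2 (Or.inr hω.2)⟩
  by_cases hyb : y = b
  · subst hyb
    calc μ.real (L ∩ U) ≤ μ.real (L ∩ (Nv x ∪ Nv z)) := by
          refine measureReal_mono fun ω hω => ⟨hω.1, ?_⟩
          rcases (hUmem ω).1 hω.2 with hx | hy | hz
          · exact Or.inl hx
          · rcases hω.1 with hzb' | ⟨hz', _⟩
            · obtain ⟨n, hn, hny⟩ := hy
              exact Or.inr ⟨n, hn, hny.trans (hzb' : (openGraph ω).Reachable z y).symm⟩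
            · exact Or.inr hz'
          · exact Or.inr hz
      _ ≤ μ.real (Nv y ∩ (Nv x ∪ Nv z)) := hpair x hzx
      _ ≤ μ.real (Nv y ∩ U) := by
          refine measureReal_mono fun ω hω => ⟨hω.1, (hUmem ω).2 ?_⟩
          rcases hω.2 with hx | hz
          · exact Or.inl hx
          · exact Or.inr (Or.inr hz)
  -- generic case: the set-observer marker dominance chain
  exact gluedPreFKG_three_of_setMDL_allWeights setMDL_schema.{u} w N b x y z hbN (fun h => hxb h) (fun h => hyb h)
    (fun h => hzb h) hxy hxz hyz hzx hzy

/-- **The set form of (41) at three relays, no side condition**: `μ({z↔b} ∩ {N↔{x,y,z}}) ≤ μ({N↔b} ∩ {N↔{x,y,z}})` whenever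
`μ(z↔b) ≤ μ(x↔b), μ(y↔b)` (weaker than `gluedPreFKG_three` by `μ(N↔b, N↔z, z↮b)`).
[cite: KozmaNitzan2024, Question 9 (§5.5 p. 36), §5.1 (pp. 31–32)] -/
theorem setPreFKG_three (w : Sym2 V → unitInterval) (N : Set V) (b x y z : V)
    (hzx : (prodBernoulli w).real (openConn z b) ≤ (prodBernoulli w).real (openConn x b))
    (hzy : (prodBernoulli w).real (openConn z b) ≤ (prodBernoulli w).real (openConn y b)) :
    (prodBernoulli w).real (openConn z b ∩
        ⋃ a ∈ ({x, y, z} : Finset V), {ω : BondConfig V | ∃ n ∈ N, (openGraph ω).Reachable n a}) ≤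
      (prodBernoulli w).real ({ω : BondConfig V | ∃ n ∈ N, (openGraph ω).Reachable n b} ∩
        ⋃ a ∈ ({x, y, z} : Finset V), {ω : BondConfig V | ∃ n ∈ N, (openGraph ω).Reachable n a}) := by
  refine le_trans ?_ (gluedPreFKG_three w N b x y z hzx hzy)
  refine measureReal_mono (fun ω hω => ?_) (measure_ne_top _ _)
  exact ⟨Or.inl hω.1, hω.2⟩

end Q7Psi

/-! ### Kozma–Nitzan's Question 9 for three relays -/

namespace KnQ9

variable {V : Type*} [Fintype V]

/-- **KOZMA–NITZAN'S QUESTION 9 HOLDS FOR THREE RELAYS.**  On every finite weighted graph: for an observer `0`, a target `b`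
and relays `x, y, z ≠ 0` with `μ_H(z ↔ b) ≤ μ_H(x ↔ b)` and `μ_H(z ↔ b) ≤ μ_H(y ↔ b)`, where `H = restrW {0}ᶜ w` is the graph
with the pairs at `0` removed, the pre-FKG inequality (41) holds for `z`:
`μ({z↔b} ∩ {0↔{x,y,z}}) ≤ μ({0↔b} ∩ {0↔{x,y,z}})`.
Proof: `b = 0` is trivial; otherwise the star decomposition `block41_of_stars` and, in each star `B ∌ 0`, the glued
inequality `Q7Psi.gluedPreFKG_three` in `H` with `N = B`.
[cite: KozmaNitzan2024, Question 9 (§5.5 p. 36); Lemma 5, Theorems 4–5 (pp. 12–14)] -/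
theorem knQuestion9_three (w : Sym2 V → unitInterval) (o b x y z : V) (hxo : x ≠ o) (hyo : y ≠ o) (hzo : z ≠ o)
    (hminx : (prodBernoulli (restrW ({o}ᶜ : Set V) w)).real (openConn z b) ≤
      (prodBernoulli (restrW ({o}ᶜ : Set V) w)).real (openConn x b))
    (hminy : (prodBernoulli (restrW ({o}ᶜ : Set V) w)).real (openConn z b) ≤
      (prodBernoulli (restrW ({o}ᶜ : Set V) w)).real (openConn y b)) :
    (prodBernoulli w).real (openConn z b ∩ ⋃ a ∈ ({x, y, z} : Finset V), openConn o a) ≤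
      (prodBernoulli w).real (openConn o b ∩ ⋃ a ∈ ({x, y, z} : Finset V), openConn o a) := by
  by_cases hbo : b = o
  · subst hbo
    exact measureReal_mono fun ω hω => ⟨SimpleGraph.Reachable.refl _, hω.2⟩
  have ho : o ∉ ({x, y, z} : Finset V) := by
    simp only [Finset.mem_insert, Finset.mem_singleton, not_or]
    exact ⟨fun h => hxo h.symm, fun h => hyo h.symm, fun h => hzo h.symm⟩
  refine block41_of_stars w {x, y, z} o b z hzo hbo ho fun B _ => ?_
  have hA : {ω : BondConfig V | ∃ a ∈ ({x, y, z} : Finset V), ∃ u ∈ B, (openGraph ω).Reachable u a} =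
      ⋃ a ∈ ({x, y, z} : Finset V), {ω : BondConfig V | ∃ n ∈ (↑B : Set V), (openGraph ω).Reachable n a} := by
    ext ω
    simp only [mem_setOf_eq, mem_iUnion, Finset.mem_coe, exists_prop]
  have hz : {ω : BondConfig V | ∃ u ∈ B, (openGraph ω).Reachable z u} =
      {ω : BondConfig V | ∃ n ∈ (↑B : Set V), (openGraph ω).Reachable n z} := by
    ext ω
    simp only [mem_setOf_eq, Finset.mem_coe]
    exact exists_congr fun u => and_congr_right fun _ => SimpleGraph.reachable_comm
  have hb : {ω : BondConfig V | ∃ u ∈ B, (openGraph ω).Reachable u b} =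
      {ω : BondConfig V | ∃ n ∈ (↑B : Set V), (openGraph ω).Reachable n b} := by
    ext ω
    simp only [mem_setOf_eq, Finset.mem_coe]
  rw [hA, hz, hb]
  exact Q7Psi.gluedPreFKG_three (restrW ({o}ᶜ : Set V) w) ↑B b x y z hminx hminy

/-- **Question 9 for every relay set with at most three relays**, in the shape of the hypothesis of
`SoloBlindKN.knQuestion7_of_question9` and `KnQ9Sure.question9_of_sureObserver`: `0 ∉ A`, `|A| ≤ 3`, `a ∈ A` minimising
`μ_H(· ↔ b)` over `A`, `H = restrW {0}ᶜ w` ⟹ `μ({a↔b} ∩ {0↔A}) ≤ μ({0↔b} ∩ {0↔A})`.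
[cite: KozmaNitzan2024, Question 9 (§5.5 p. 36)] -/
theorem knQuestion9_of_card_le_three (w : Sym2 V → unitInterval) (A : Finset V) (o b a : V) (hA : A.card ≤ 3)
    (ho : o ∉ A) (ha : a ∈ A)
    (hmin : ∀ a' ∈ A, (prodBernoulli (restrW ({o}ᶜ : Set V) w)).real (openConn a b) ≤
      (prodBernoulli (restrW ({o}ᶜ : Set V) w)).real (openConn a' b)) :
    (prodBernoulli w).real (openConn a b ∩ ⋃ a' ∈ A, openConn o a') ≤
      (prodBernoulli w).real (openConn o b ∩ ⋃ a' ∈ A, openConn o a') := by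
  by_cases h2 : A.card ≤ 2
  · exact knQuestion9_of_card_le_two w A o b a h2 ho ha hmin
  -- `|A| = 3`: `A = {x, y, a}`
  have h3 : A.card = 3 := le_antisymm hA (by omega)
  obtain ⟨x, y, z, hxy, hxz, hyz, hAeq⟩ := Finset.card_eq_three.1 h3
  -- put the designated relay last
  obtain ⟨u, v, hAeq'⟩ : ∃ u v : V, A = {u, v, a} := by
    rw [hAeq] at ha
    simp only [Finset.mem_insert, Finset.mem_singleton] at ha
    rcases ha with rfl | rfl | rfl
    · exact ⟨y, z, by rw [hAeq]; ext t; simp only [Finset.mem_insert, Finset.mem_singleton]; tauto⟩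
    · exact ⟨x, z, by rw [hAeq]; ext t; simp only [Finset.mem_insert, Finset.mem_singleton]; tauto⟩
    · exact ⟨x, y, hAeq⟩
  have huA : u ∈ A := by rw [hAeq']; simp
  have hvA : v ∈ A := by rw [hAeq']; simp
  have huo : u ≠ o := fun h => ho (h ▸ huA)
  have hvo : v ≠ o := fun h => ho (h ▸ hvA)
  have hao : a ≠ o := fun h => ho (h ▸ ha)
  rw [hAeq']
  exact knQuestion9_three w o b u v a huo hvo hao (hmin u huA) (hmin v hvA)

end KnQ9

end

end Summit.CriticalPhenomena.PercolationContinuityZ3.Theorems
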